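/-
Copyright (c) 2026 the pub-hodgecm-mathlib formalisation cell (harness21).  Prover seat hodgecm-mathlib-F0P3a-p04 (g31), 2026-09-03.  E1 row 47d R-d «ASSEMBLY»
(E1 keeper F0P3a-p03 (g29) 02:28:58Z ∕ (g30) 02:54:22Z; census row 47 `CENSUS-NONELL-VANISHING.v1` (F0P3-p02 (g26)) §2 (A1)–(A3), §5 R47-d).
-/
import Literature.NumberTheory.Automorphic.SmoothCharacterEPFunctionTrace   -- ★ row 42 (F0P2-p01): `smoothTrace_epFunction`, `epFunction_mem_schwartzBruhat`
import HarnessLib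

/-!
# The induced trace of an Euler–Poincaré function vanishes: `tr π′(f_EP) = 0` once its `K`-type multiplicities are fixed-block sums satisfying the Jacquet Euler identity
# (Schneider–Stuhler 1997 §III.4; Kottwitz 1988 §2; Bernstein–Zelevinsky 1976 §2.3)

Topic `NumberTheory/Automorphic`; declarations in Mathlib's `Representation` namespace (dot-style on the admissible `ρ = π′`, as ★ row 42).  THEOREMS ONLY (no definition, no instance, no
notation, no named fact, no `sorry`).  Cell `pub/hodgecm-mathlib` (D-0151), crux H413 = `stmt-HodgeConjecture-24833`, lane `--supports`; E1 BRICK LEDGER row 47d «ASSEMBLY» of census row 47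
route A: (A1) ★ row 42 `tr π′(f_EP) = Σ_i (−1)^{d_i} m_i`, `m_i = dim Hom_{P_i}(W_i, π′|_{P_i})`; (A2)+(G1)–(G3) per facet orbit `m_i = Σ_{r ∈ J_i} e r` over the apartment facets `J_i ⊆ B∖X_{d_i}`
reached by the double cosets `B∖Γ∕P_{F_i}` (★ 47b Mackey + ★ 47d-glue `IntertwiningMapSemidirectTransport` ∕ `IntertwiningMapCharacterCoinvariants`), `e r = dim` of the `χ′`-eigenspace of
`T_c` on `(V^{U_r})_{N ∩ P_r}`; (A3) the ISOTYPIC JACQUET EULER IDENTITY `Σ_{r ∈ S₁} e r = Σ_{r ∈ S₀} e r` (★ 47c FILE 4 ∕ 4χ, `S_q = B∖X_q`).  This file is the finite-sum bookkeeping that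
turns these three inputs — the last two carried HYPOTHESIS-STYLE (`hm`, `hJ`, `hEuler`) — into `tr π′(f_EP) = 0`; the instances at `π′ = i_B χ` are the files named above and 47e
(datum).  HONEST LABEL: count-neutral generic base layer; (R-SS) NOT chartered; E1 = PRINT until the keeper's charter test; HC_CM is proved only modulo the 2 remaining named inputs
(hLiu418 = `stmt-HodgeConjecture-24832`, h413 = `stmt-HodgeConjecture-24833`) until rung 0 closes.

* §1 `sum_signed_eq_zero_of_blockSums` — pure `Finset` algebra: `Σ_i (−1)^{d_i} m_i = 0` from `m_i = Σ_{r ∈ J_i} e r`, `d_i ∈ {0,1}`, the `J_i` partitioning `S₀` (`d_i = 0`) and `S₁`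
  (`d_i = 1`), and `Σ_{S₁} e = Σ_{S₀} e`.
* §2 **`smoothTrace_epFunction_eq_zero_of_blockSums`** — the head: `ρ.smoothTrace μ (Σ_i (−1)^{d_i} • μ(P_i)⁻¹ • f_i) = 0` (★ row 42 letters verbatim + `hm`, `hJ…`, `hEuler`);
  `smoothTrace_epFunction_eq_zero_of_signed_sum_eq_zero` — the same from the single hypothesis `Σ_i (−1)^{d_i} m_i = 0`.

## References
* [SchneiderStuhler1997] P. Schneider, U. Stuhler, *Representation theory and sheaves on the Bruhat–Tits building*, Publ. Math. IHÉS 85 (1997): §III.4 (traces of Euler–Poincaré functions,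
  `EP(V, Ind E) = 0` Lemma III.4.18 ii).
* [Kottwitz1988] R. E. Kottwitz, *Tamagawa numbers*, Ann. of Math. 127 (1988): §2 (the Euler–Poincaré function and the vanishing of its non-elliptic orbital integrals).
* [BernsteinZelevinsky1976] I. N. Bernstein, A. V. Zelevinsky, *Representations of the group GL(n, F)*, Russian Math. Surveys 31 (1976): §2.3.
-/

set_option autoImplicit false

open MeasureTheory
open scoped BigOperators

namespace Representation

/-! ## §1 The finite-sum bookkeeping -/

/-- **`Σ_i (−1)^{d_i} m_i = 0`** when `m_i = Σ_{r ∈ J_i} e r`, every `d_i` is `0` or `1`, the families `(J_i)_{d_i = 0}` and `(J_i)_{d_i = 1}` are pairwise disjoint with unions `S₀` and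
`S₁`, and `Σ_{r ∈ S₁} e r = Σ_{r ∈ S₀} e r`. [cite: SchneiderStuhler1997, III.4] -/
theorem sum_signed_eq_zero_of_blockSums {ι β R : Type*} [CommRing R] [DecidableEq ι] [DecidableEq β] (s : Finset ι) (d : ι → ℕ) (m : ι → R) (e : β → R) (J : ι → Finset β)
    (S₀ S₁ : Finset β) (hd : ∀ i ∈ s, d i = 0 ∨ d i = 1) (hm : ∀ i ∈ s, m i = ∑ r ∈ J i, e r)
    (hdisj : ∀ i ∈ s, ∀ i' ∈ s, i ≠ i' → Disjoint (J i) (J i'))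
    (hS₀ : S₀ = (s.filter fun i => d i = 0).biUnion J) (hS₁ : S₁ = (s.filter fun i => d i = 1).biUnion J)
    (hEuler : ∑ r ∈ S₁, e r = ∑ r ∈ S₀, e r) :
    ∑ i ∈ s, (-1 : R) ^ d i * m i = 0 := by
  -- split `s` by the parity of `d`
  have hsplit : ∑ i ∈ s, (-1 : R) ^ d i * m i = (∑ i ∈ s.filter fun i => d i = 0, m i) - ∑ i ∈ s.filter fun i => d i = 1, m i := by
    rw [← Finset.sum_filter_add_sum_filter_not s (fun i => d i = 0)]
    have h0 : ∑ i ∈ s.filter (fun i => d i = 0), (-1 : R) ^ d i * m i = ∑ i ∈ s.filter (fun i => d i = 0), m i :=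
      Finset.sum_congr rfl fun i hi => by rw [(Finset.mem_filter.1 hi).2, pow_zero, one_mul]
    have hnot : s.filter (fun i => ¬ d i = 0) = s.filter fun i => d i = 1 := by
      refine Finset.filter_congr fun i hi => ?_
      rcases hd i hi with h | h
      · simp [h]
      · simp [h]
    have h1 : ∑ i ∈ s.filter (fun i => ¬ d i = 0), (-1 : R) ^ d i * m i = -∑ i ∈ s.filter (fun i => d i = 1), m i := by
      rw [hnot, ← Finset.sum_neg_distrib]
      exact Finset.sum_congr rfl fun i hi => by rw [(Finset.mem_filter.1 hi).2, pow_one, neg_one_mul]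
    rw [h0, h1, sub_eq_add_neg]
  -- each parity class sums to `Σ_{S_q} e`
  have hbi : ∀ q : ℕ, ∑ i ∈ s.filter (fun i => d i = q), m i = ∑ r ∈ (s.filter fun i => d i = q).biUnion J, e r := fun q => by
    rw [Finset.sum_biUnion (fun i hi i' hi' hne => hdisj i (Finset.mem_filter.1 hi).1 i' (Finset.mem_filter.1 hi').1 hne)]
    exact Finset.sum_congr rfl fun i hi => hm i (Finset.mem_filter.1 hi).1
  rw [hsplit, hbi 0, hbi 1, ← hS₀, ← hS₁, hEuler, sub_self]

/-! ## §2 The head: `tr π′(f_EP) = 0` -/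

section Head

variable {G : Type*} [TopologicalSpace G] [Group G] [NonarchimedeanGroup G] [LocallyCompactSpace G] [MeasurableSpace G] [BorelSpace G]
  {V : Type*} [AddCommGroup V] [Module ℂ V] (ρ : Representation ℂ G V)
  (μ : Measure G) [μ.IsMulLeftInvariant] [IsFiniteMeasureOnCompacts μ]
variable {ι : Type*} (s : Finset ι) (U P : ι → Subgroup G)
  {W : ι → Type*} [∀ i, AddCommGroup (W i)] [∀ i, Module ℂ (W i)] (τ : ∀ i, Representation ℂ (P i) (W i)) (f : ι → G → ℂ) (d : ι → ℕ)

/-- **`tr π′(f_EP) = 0` FROM `Σ_i (−1)^{d_i} dim Hom_{P_i}(W_i, π′|_{P_i}) = 0`** (★ row 42 + the vanishing of the signed multiplicity sum). [cite: SchneiderStuhler1997, III.4]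
[cite: Kottwitz1988, §2] -/
theorem smoothTrace_epFunction_eq_zero_of_signed_sum_eq_zero (hadm : ρ.IsAdmissible) [∀ i, FiniteDimensional ℂ (W i)]
    (hUo : ∀ i ∈ s, IsOpen (U i : Set G)) (hUc : ∀ i ∈ s, IsCompact (U i : Set G)) (hPc : ∀ i ∈ s, IsCompact (P i : Set G))
    (hUP : ∀ i, U i ≤ P i) (hPU : ∀ i ∈ s, P i ≤ Subgroup.normalizer (U i : Set G)) (hμP : ∀ i ∈ s, μ.real (P i : Set G) ≠ 0)
    (hτ : ∀ i ∈ s, ∀ (u : G) (hu : u ∈ U i), τ i ⟨u, hUP i hu⟩ = 1)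
    (hfP : ∀ i ∈ s, ∀ (g : G) (hg : g ∈ P i), f i g = (τ i).character ⟨g, hg⟩⁻¹) (hf0 : ∀ i ∈ s, ∀ g ∉ P i, f i g = 0)
    (hzero : ∑ i ∈ s, (-1 : ℂ) ^ d i * Module.finrank ℂ (IntertwiningMap (τ i) (ρ.comp (P i).subtype)) = 0) :
    ρ.smoothTrace μ (∑ i ∈ s, ((-1 : ℂ) ^ d i) • ((μ.real (P i : Set G) : ℂ))⁻¹ • f i) = 0 := by
  rw [ρ.smoothTrace_epFunction μ s U P τ f d hadm hUo hUc hPc hUP hPU hμP hτ hfP hf0]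
  exact hzero

/-- **`tr π′(f_EP^{V,e}) = 0` — THE ASSEMBLY** (census row 47 route A (A1)+(A2)+(A3)).  Letters of ★ row 42 for the Euler–Poincaré-type function `Σ_i (−1)^{d_i} μ(P_i)⁻¹ • f_i` and the
admissible `π′ = ρ`; the MULTIPLICITIES `m_i = dim Hom_{P_i}(W_i, π′|_{P_i})` are fixed-block sums `m_i = Σ_{r ∈ J_i} e r` (`hm` — at `π′ = i_B χ`: ★ 47b Mackey along `B∖Γ∕P_{F_i}` + ★ 47d-glue
transport ∕ semidirect Frobenius ∕ `dim Hom_{T_c}(Q, χ′) = dim Q^{(χ′)}`), the blocks `J_i` of the vertex orbits (`d_i = 0`) partition `S₀ = B∖X₀` and those of the edge orbits (`d_i = 1`) partition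
`S₁ = B∖X₁` (`hdisj`, `hS₀`, `hS₁` — the orbit–stabiliser reindexing `⊔_i B∖Γ∕P_{F_i} ≃ B∖X_{d_i}`), and the numbers `e r` satisfy the ISOTYPIC JACQUET EULER IDENTITY `Σ_{S₁} e = Σ_{S₀} e`
(`hEuler` — ★ 47c FILE 4 ∕ 4χ on the Schneider–Stuhler resolution).  Then **`tr π′(f_EP) = 0`**: `EP(V, Ind) = 0` [SS97 Lemma III.4.18 ii] without `Ext`, density or Bernstein centre.
[cite: SchneiderStuhler1997, III.4] [cite: Kottwitz1988, §2] [cite: BernsteinZelevinsky1976, §2.3] -/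
theorem smoothTrace_epFunction_eq_zero_of_blockSums [DecidableEq ι] (hadm : ρ.IsAdmissible) [∀ i, FiniteDimensional ℂ (W i)]
    (hUo : ∀ i ∈ s, IsOpen (U i : Set G)) (hUc : ∀ i ∈ s, IsCompact (U i : Set G)) (hPc : ∀ i ∈ s, IsCompact (P i : Set G))
    (hUP : ∀ i, U i ≤ P i) (hPU : ∀ i ∈ s, P i ≤ Subgroup.normalizer (U i : Set G)) (hμP : ∀ i ∈ s, μ.real (P i : Set G) ≠ 0)
    (hτ : ∀ i ∈ s, ∀ (u : G) (hu : u ∈ U i), τ i ⟨u, hUP i hu⟩ = 1)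
    (hfP : ∀ i ∈ s, ∀ (g : G) (hg : g ∈ P i), f i g = (τ i).character ⟨g, hg⟩⁻¹) (hf0 : ∀ i ∈ s, ∀ g ∉ P i, f i g = 0)
    {β : Type*} [DecidableEq β] (e : β → ℕ) (J : ι → Finset β) (S₀ S₁ : Finset β)
    (hd : ∀ i ∈ s, d i = 0 ∨ d i = 1)
    (hm : ∀ i ∈ s, Module.finrank ℂ (IntertwiningMap (τ i) (ρ.comp (P i).subtype)) = ∑ r ∈ J i, e r)
    (hdisj : ∀ i ∈ s, ∀ i' ∈ s, i ≠ i' → Disjoint (J i) (J i'))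
    (hS₀ : S₀ = (s.filter fun i => d i = 0).biUnion J) (hS₁ : S₁ = (s.filter fun i => d i = 1).biUnion J)
    (hEuler : ∑ r ∈ S₁, e r = ∑ r ∈ S₀, e r) :
    ρ.smoothTrace μ (∑ i ∈ s, ((-1 : ℂ) ^ d i) • ((μ.real (P i : Set G) : ℂ))⁻¹ • f i) = 0 := by
  refine ρ.smoothTrace_epFunction_eq_zero_of_signed_sum_eq_zero μ s U P τ f d hadm hUo hUc hPc hUP hPU hμP hτ hfP hf0 ?_
  refine sum_signed_eq_zero_of_blockSums s d (fun i => (Module.finrank ℂ (IntertwiningMap (τ i) (ρ.comp (P i).subtype)) : ℂ)) (fun r => (e r : ℂ)) J S₀ S₁ hd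
    (fun i hi => by rw [hm i hi]; push_cast; rfl) hdisj hS₀ hS₁ (by exact_mod_cast hEuler)

end Head

/-! ## §3 The two-sorted form with the reindexing built in: vertex types minus edge types -/

section TwoSorted

open Literature.NumberTheory.Automorphic

variable {G : Type*} [TopologicalSpace G] [Group G] [NonarchimedeanGroup G] [LocallyCompactSpace G] [MeasurableSpace G] [BorelSpace G]
  {V : Type*} [AddCommGroup V] [Module ℂ V] (ρ : Representation ℂ G V)
  (μ : Measure G) [μ.IsMulLeftInvariant] [IsFiniteMeasureOnCompacts μ]
variable {ι₀ : Type*} (s₀ : Finset ι₀) (U₀ P₀ : ι₀ → Subgroup G)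
  {W₀ : ι₀ → Type*} [∀ i, AddCommGroup (W₀ i)] [∀ i, Module ℂ (W₀ i)] (τ₀ : ∀ i, Representation ℂ (P₀ i) (W₀ i)) (f₀ : ι₀ → G → ℂ)
variable {ι₁ : Type*} (s₁ : Finset ι₁) (U₁ P₁ : ι₁ → Subgroup G)
  {W₁ : ι₁ → Type*} [∀ i, AddCommGroup (W₁ i)] [∀ i, Module ℂ (W₁ i)] (τ₁ : ∀ i, Representation ℂ (P₁ i) (W₁ i)) (f₁ : ι₁ → G → ℂ)

/-- Reindexing a sum over the blocks: if `S` is exactly the set of values `r i j` (`i ∈ s`, `j : κ i`), injectively in `j` and disjointly in `i`, then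
`Σ_{b ∈ S} e b = Σ_{i ∈ s} Σ_j e (r i j)`. [cite: SchneiderStuhler1997, III.4] -/
theorem sum_eq_sum_sum_of_blocks {ι β : Type*} [DecidableEq β] {R : Type*} [AddCommMonoid R] (s : Finset ι) {κ : ι → Type*} [∀ i, Fintype (κ i)]
    (r : ∀ i, κ i → β) (e : β → R) (S : Finset β) (hS : ∀ b, b ∈ S ↔ ∃ i ∈ s, ∃ j, r i j = b) (hinj : ∀ i ∈ s, Function.Injective (r i))
    (hdisj : ∀ i ∈ s, ∀ i' ∈ s, i ≠ i' → ∀ j j', r i j ≠ r i' j') :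
    ∑ b ∈ S, e b = ∑ i ∈ s, ∑ j, e (r i j) := by
  classical
  have hSeq : S = s.biUnion fun i => Finset.univ.image (r i) := by
    ext b
    simp only [hS, Finset.mem_biUnion, Finset.mem_image, Finset.mem_univ, true_and]
  rw [hSeq, Finset.sum_biUnion]
  · refine Finset.sum_congr rfl fun i hi => ?_
    rw [Finset.sum_image fun j _ j' _ h => hinj i hi h]
  · intro i hi i' hi' hne
    simp only [Function.onFun]
    rw [Finset.disjoint_left]
    intro b hb hb'
    obtain ⟨j, -, rfl⟩ := Finset.mem_image.1 hb
    obtain ⟨j', -, hjj'⟩ := Finset.mem_image.1 hb'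
    exact hdisj i hi i' hi' hne j j' hjj'.symm

/-- **`tr π(f_EP) = 0`, TWO-SORTED FORM WITH THE REINDEXING BUILT IN**: for VERTEX types `i ∈ s₀` and EDGE types `i ∈ s₁` with ★ row 42's test-function data (`U P τ f` and the
hypotheses `hUo … hf0` of `smoothTrace_epFunction`, sort by sort), BLOCKWISE MULTIPLICITIES `dim Hom_{P_i}(W_i, π|_{P_i}) = Σ_j e (r i j)` (`hm₀`, `hm₁` — ★ 47d-(α) + (G4) per
type), blocks `S₀`, `S₁` that are exactly the `r i j` (injective in `j`, disjoint in `i` — the orbit–stabiliser reindexing `⊔_i B∖Γ∕P_{F_i} ≃ B∖X_q`), and the Jacquet Euler identity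
`Σ_{S₁} e₁ = Σ_{S₀} e₀` (`hEuler` — ★ 47c FILE 4 ∕ 4χ-b ∕ FILE 5b): **`tr π (Σ_{i ∈ s₀} μ(P_i)⁻¹ f_i − Σ_{i ∈ s₁} μ(P_i)⁻¹ f_i) = 0`** (★ row 42 on each sort, linearity of the
trace on Schwartz–Bruhat functions, §1-style algebra). [cite: SchneiderStuhler1997, III.4 Lemma III.4.18] [cite: Kottwitz1988, §2] -/
theorem smoothTrace_epFunction_sub_eq_zero_of_blockSums (hadm : ρ.IsAdmissible) [∀ i, FiniteDimensional ℂ (W₀ i)] [∀ i, FiniteDimensional ℂ (W₁ i)]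
    (hUo₀ : ∀ i ∈ s₀, IsOpen (U₀ i : Set G)) (hUc₀ : ∀ i ∈ s₀, IsCompact (U₀ i : Set G)) (hPc₀ : ∀ i ∈ s₀, IsCompact (P₀ i : Set G))
    (hUP₀ : ∀ i, U₀ i ≤ P₀ i) (hPU₀ : ∀ i ∈ s₀, P₀ i ≤ Subgroup.normalizer (U₀ i : Set G)) (hμP₀ : ∀ i ∈ s₀, μ.real (P₀ i : Set G) ≠ 0)
    (hτ₀ : ∀ i ∈ s₀, ∀ (u : G) (hu : u ∈ U₀ i), τ₀ i ⟨u, hUP₀ i hu⟩ = 1)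
    (hfP₀ : ∀ i ∈ s₀, ∀ (g : G) (hg : g ∈ P₀ i), f₀ i g = (τ₀ i).character ⟨g, hg⟩⁻¹) (hf0₀ : ∀ i ∈ s₀, ∀ g ∉ P₀ i, f₀ i g = 0)
    (hUo₁ : ∀ i ∈ s₁, IsOpen (U₁ i : Set G)) (hUc₁ : ∀ i ∈ s₁, IsCompact (U₁ i : Set G)) (hPc₁ : ∀ i ∈ s₁, IsCompact (P₁ i : Set G))
    (hUP₁ : ∀ i, U₁ i ≤ P₁ i) (hPU₁ : ∀ i ∈ s₁, P₁ i ≤ Subgroup.normalizer (U₁ i : Set G)) (hμP₁ : ∀ i ∈ s₁, μ.real (P₁ i : Set G) ≠ 0)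
    (hτ₁ : ∀ i ∈ s₁, ∀ (u : G) (hu : u ∈ U₁ i), τ₁ i ⟨u, hUP₁ i hu⟩ = 1)
    (hfP₁ : ∀ i ∈ s₁, ∀ (g : G) (hg : g ∈ P₁ i), f₁ i g = (τ₁ i).character ⟨g, hg⟩⁻¹) (hf0₁ : ∀ i ∈ s₁, ∀ g ∉ P₁ i, f₁ i g = 0)
    {β₀ β₁ : Type*} [DecidableEq β₀] [DecidableEq β₁] (e₀ : β₀ → ℕ) (e₁ : β₁ → ℕ)
    {κ₀ : ι₀ → Type*} [∀ i, Fintype (κ₀ i)] (r₀ : ∀ i, κ₀ i → β₀) {κ₁ : ι₁ → Type*} [∀ i, Fintype (κ₁ i)] (r₁ : ∀ i, κ₁ i → β₁)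
    (hm₀ : ∀ i ∈ s₀, Module.finrank ℂ (IntertwiningMap (τ₀ i) (ρ.comp (P₀ i).subtype)) = ∑ j, e₀ (r₀ i j))
    (hm₁ : ∀ i ∈ s₁, Module.finrank ℂ (IntertwiningMap (τ₁ i) (ρ.comp (P₁ i).subtype)) = ∑ j, e₁ (r₁ i j))
    (S₀ : Finset β₀) (hS₀ : ∀ b, b ∈ S₀ ↔ ∃ i ∈ s₀, ∃ j, r₀ i j = b) (hinj₀ : ∀ i ∈ s₀, Function.Injective (r₀ i))
    (hdisj₀ : ∀ i ∈ s₀, ∀ i' ∈ s₀, i ≠ i' → ∀ j j', r₀ i j ≠ r₀ i' j')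
    (S₁ : Finset β₁) (hS₁ : ∀ b, b ∈ S₁ ↔ ∃ i ∈ s₁, ∃ j, r₁ i j = b) (hinj₁ : ∀ i ∈ s₁, Function.Injective (r₁ i))
    (hdisj₁ : ∀ i ∈ s₁, ∀ i' ∈ s₁, i ≠ i' → ∀ j j', r₁ i j ≠ r₁ i' j')
    (hEuler : ∑ b ∈ S₁, e₁ b = ∑ b ∈ S₀, e₀ b) :
    ρ.smoothTrace μ (∑ i ∈ s₀, ((μ.real (P₀ i : Set G) : ℂ))⁻¹ • f₀ i - ∑ i ∈ s₁, ((μ.real (P₁ i : Set G) : ℂ))⁻¹ • f₁ i) = 0 := by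
  -- both sums are Schwartz–Bruhat functions
  have hmem₀ : (∑ i ∈ s₀, ((μ.real (P₀ i : Set G) : ℂ))⁻¹ • f₀ i) ∈ SchwartzBruhat G :=
    Submodule.sum_mem _ fun i hi => Submodule.smul_mem _ _
      (mem_schwartzBruhat_of_kType (hUo₀ i hi) (hUc₀ i hi) (hPc₀ i hi) (hUP₀ i) (hPU₀ i hi) (τ₀ i) (hτ₀ i hi) (hfP₀ i hi) (hf0₀ i hi))
  have hmem₁ : (∑ i ∈ s₁, ((μ.real (P₁ i : Set G) : ℂ))⁻¹ • f₁ i) ∈ SchwartzBruhat G :=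
    Submodule.sum_mem _ fun i hi => Submodule.smul_mem _ _
      (mem_schwartzBruhat_of_kType (hUo₁ i hi) (hUc₁ i hi) (hPc₁ i hi) (hUP₁ i) (hPU₁ i hi) (τ₁ i) (hτ₁ i hi) (hfP₁ i hi) (hf0₁ i hi))
  -- ★ row 42 on each sort (all signs `+`)
  have h₀ := ρ.smoothTrace_epFunction μ s₀ U₀ P₀ τ₀ f₀ (fun _ => 0) hadm hUo₀ hUc₀ hPc₀ hUP₀ hPU₀ hμP₀ hτ₀ hfP₀ hf0₀
  have h₁ := ρ.smoothTrace_epFunction μ s₁ U₁ P₁ τ₁ f₁ (fun _ => 0) hadm hUo₁ hUc₁ hPc₁ hUP₁ hPU₁ hμP₁ hτ₁ hfP₁ hf0₁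
  simp only [pow_zero, one_smul, one_mul] at h₀ h₁
  rw [ρ.smoothTrace_sub_of_mem μ hadm hmem₀ hmem₁, h₀, h₁, sub_eq_zero]
  -- the reindexed Euler identity
  have key : ∑ i ∈ s₁, (∑ j, e₁ (r₁ i j)) = ∑ i ∈ s₀, (∑ j, e₀ (r₀ i j)) := by
    rw [← sum_eq_sum_sum_of_blocks s₁ r₁ e₁ S₁ hS₁ hinj₁ hdisj₁, ← sum_eq_sum_sum_of_blocks s₀ r₀ e₀ S₀ hS₀ hinj₀ hdisj₀, hEuler]
  have c₀ : ∀ i ∈ s₀, ((Module.finrank ℂ (IntertwiningMap (τ₀ i) (ρ.comp (P₀ i).subtype)) : ℂ)) = ∑ j, ((e₀ (r₀ i j) : ℕ) : ℂ) := fun i hi => by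
    rw [hm₀ i hi, Nat.cast_sum]
  have c₁ : ∀ i ∈ s₁, ((Module.finrank ℂ (IntertwiningMap (τ₁ i) (ρ.comp (P₁ i).subtype)) : ℂ)) = ∑ j, ((e₁ (r₁ i j) : ℕ) : ℂ) := fun i hi => by
    rw [hm₁ i hi, Nat.cast_sum]
  rw [Finset.sum_congr rfl c₀, Finset.sum_congr rfl c₁]
  exact_mod_cast key.symm

end TwoSorted

end Representation
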